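import Mathlib
import HarnessLib
import Summits.HubbardSuperconductivity.HubbardSuperconductivity.Theorems.ComplexGFFStiffnessHolomorphicFreeHtEngines
import Summits.HubbardSuperconductivity.HubbardSuperconductivity.Theorems.ComplexGFFStiffnessFreeHtBall
import Literature.MathematicalPhysics.StatisticalMechanics.AbkmPackageNextHTwoKernel

/-!
# Crux child `TwoKernelSkBound` (stmt-HubbardSuperconductivity-27414), line `banach_two_kernel`, stub `stub_f4l2ShrinkLoc` —
# block B1, PARALLELOGRAM part: `Ψ(H̃_{q+y} + H̃_{q+z} − H̃_q) − Ψ(H̃_{q+y}) − Ψ(H̃_{q+z}) + Ψ(H̃_q)` is `O(|y|₁|z|₁max(‖u‖,c_v))`, `N`-free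

Route `route-HubbardSuperconductivity-ComplexGFFStiffness`; memo `Cruxes/HypACumulant/TWOKERNEL-PLAN-27414-v3.md` §0/§2 (R3).  With
`Ψ(H̃) = nextK D_{q+y+z}.s π (stepMeasure D_{q+y+z}.𝒞) (e^{−toHam u}) (e^{−H̃}) (mulExt v)`, `δ_y = H̃_{q+y} − H̃_q`, `δ_z = H̃_{q+z} − H̃_q`
(`‖δ_y‖ ≤ ℓ_H|y|₁mx`, `‖δ_z‖ ≤ ℓ_H|z|₁mx`, p827565), the exact parallelogram `Ψ(H̃_q+δ_y+δ_z) − Ψ(H̃_q+δ_y) − Ψ(H̃_q+δ_z) + Ψ(H̃_q)` is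
bounded by the bidisc engine `weakNormLE_secondDiff_nextK_freeHt_package` (p833074) along `H̃_q + σδ_y + τ(‖δ_y‖/‖δ_z‖)δ_z` with radius
`ρ₀/(4‖δ_y‖)` at `(σ, τ) = (1, ‖δ_z‖/‖δ_y‖)` and the uniform bound `M₁` of `exists_weakNormLE_nextK_freeHt_ball` (U1, p833279): **`N`-free
`l ≥ 0`, `T₂ > 0` with weak norm `≤ l·|y|₁|z|₁·max(‖u‖,c_v)`** (`exists_weakNormLE_blockB1_parallelogram`).  With the excess part
(`ComplexGFFStiffnessF4l2BlockB1Excess`) this is block B1 of the four-corner split.  All proved, no `sorry`.  Honest scope: rung route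
(stiffness of a complex Gaussian gradient field via the [ABKM19] RG); nothing about superconductivity in the Hubbard model.

## References
* S. Adams, S. Buchholz, R. Kotecký, S. Müller, arXiv:1910.13564, Definition 6.5 (6.34), Theorem 6.8, Lemma 12.6 (12.53)
  [AdamsBuchholzKoteckyMuller2019].
-/

noncomputable section

-- `Summit.<Summit>.<Problem>`: single-conjunct summit, the duplicate component is mandated (D-0017).
set_option linter.dupNamespace false

namespace Summit.HubbardSuperconductivity.HubbardSuperconductivity.Theorems.ComplexGFF

open MeasureTheory Metric Set
open scoped BigOperators
open Literature.MathematicalPhysics.StatisticalMechanics.GradientRG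
open Literature.MathematicalPhysics.StatisticalMechanics.TorusPolymer (IsPolymer blockOf reblock)
open Literature.Barriers.CriticalPhenomena.LongRangePhi4.Polymer (IsConn)
open Literature.MathematicalPhysics.StatisticalMechanics

variable {d : ℕ}

set_option maxHeartbeats 1600000 in
/-- **Block B1, parallelogram part, `N`-free** (module docstring). [cite: AdamsBuchholzKoteckyMuller2019, Lemma 12.6 (12.53) / Definition 6.5 (6.34)] -/
theorem exists_weakNormLE_blockB1_parallelogram (P : PackageData d) [Fact (0 < P.h)] [Fact (0 < P.L)] (hr0 : 0 < P.r) :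
    ∃ l T₂ : ℝ, 0 ≤ l ∧ 0 < T₂ ∧ ∀ (N M : ℕ) [NeZero M] (Q : PackageAt P N M),
      ∀ q y z : Matrix (Fin d) (Fin d) ℝ, P.InBall q → P.InBall (q + y) → P.InBall (q + z) → P.InBall (q + y + z) →
      esum y ≤ T₂ → esum z ≤ T₂ → ∀ k, k + 1 ≤ N →
      ∀ (u : HamSpace ℂ d (fieldWt P.h (P.L : ℝ) d k) ((P.L : ℝ) ^ k) (P.L ^ (d * k)))
        (v : activitySpace Q.normParams k) (cv : ℝ), ‖u‖ ≤ P.r →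
        activityNormLE Q.normParams k v cv → cv ≤ P.r →
      WeakNormLE Q.normParams (k + 1)
        (fun X ψ =>
          nextK (abkmStepData P.L P.R k (Q.kernels (q + y + z))).s
              (reblock (abkmStepData P.L P.R k (Q.kernels (q + y + z))).s
                ((abkmStepData P.L P.R k (Q.kernels (q + y + z))).L * (abkmStepData P.L P.R k (Q.kernels (q + y + z))).s))
              (stepMeasure (abkmStepData P.L P.R k (Q.kernels (q + y + z))).𝒞) (expNegH (HamSpace.toHam u))
              (expNegH (nextH (abkmStepData P.L P.R k (Q.kernels (q + y))) (HamSpace.toHam u)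
                (mulExt ((v : activitySpace Q.normParams k) : Finset (Fin d → ZMod M) → ((Fin d → ZMod M) → ℝ) → ℂ)) +
              nextH (abkmStepData P.L P.R k (Q.kernels (q + z))) (HamSpace.toHam u)
                (mulExt ((v : activitySpace Q.normParams k) : Finset (Fin d → ZMod M) → ((Fin d → ZMod M) → ℝ) → ℂ)) -
              nextH (abkmStepData P.L P.R k (Q.kernels q)) (HamSpace.toHam u)
                (mulExt ((v : activitySpace Q.normParams k) : Finset (Fin d → ZMod M) → ((Fin d → ZMod M) → ℝ) → ℂ))))
              (mulExt ((v : activitySpace Q.normParams k) : Finset (Fin d → ZMod M) → ((Fin d → ZMod M) → ℝ) → ℂ)) X ψ -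
          nextK (abkmStepData P.L P.R k (Q.kernels (q + y + z))).s
              (reblock (abkmStepData P.L P.R k (Q.kernels (q + y + z))).s
                ((abkmStepData P.L P.R k (Q.kernels (q + y + z))).L * (abkmStepData P.L P.R k (Q.kernels (q + y + z))).s))
              (stepMeasure (abkmStepData P.L P.R k (Q.kernels (q + y + z))).𝒞) (expNegH (HamSpace.toHam u))
              (expNegH (nextH (abkmStepData P.L P.R k (Q.kernels (q + y))) (HamSpace.toHam u)
                (mulExt ((v : activitySpace Q.normParams k) : Finset (Fin d → ZMod M) → ((Fin d → ZMod M) → ℝ) → ℂ))))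
              (mulExt ((v : activitySpace Q.normParams k) : Finset (Fin d → ZMod M) → ((Fin d → ZMod M) → ℝ) → ℂ)) X ψ -
          nextK (abkmStepData P.L P.R k (Q.kernels (q + y + z))).s
              (reblock (abkmStepData P.L P.R k (Q.kernels (q + y + z))).s
                ((abkmStepData P.L P.R k (Q.kernels (q + y + z))).L * (abkmStepData P.L P.R k (Q.kernels (q + y + z))).s))
              (stepMeasure (abkmStepData P.L P.R k (Q.kernels (q + y + z))).𝒞) (expNegH (HamSpace.toHam u))
              (expNegH (nextH (abkmStepData P.L P.R k (Q.kernels (q + z))) (HamSpace.toHam u)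
                (mulExt ((v : activitySpace Q.normParams k) : Finset (Fin d → ZMod M) → ((Fin d → ZMod M) → ℝ) → ℂ))))
              (mulExt ((v : activitySpace Q.normParams k) : Finset (Fin d → ZMod M) → ((Fin d → ZMod M) → ℝ) → ℂ)) X ψ +
          nextK (abkmStepData P.L P.R k (Q.kernels (q + y + z))).s
              (reblock (abkmStepData P.L P.R k (Q.kernels (q + y + z))).s
                ((abkmStepData P.L P.R k (Q.kernels (q + y + z))).L * (abkmStepData P.L P.R k (Q.kernels (q + y + z))).s))
              (stepMeasure (abkmStepData P.L P.R k (Q.kernels (q + y + z))).𝒞) (expNegH (HamSpace.toHam u))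
              (expNegH (nextH (abkmStepData P.L P.R k (Q.kernels q)) (HamSpace.toHam u)
                (mulExt ((v : activitySpace Q.normParams k) : Finset (Fin d → ZMod M) → ((Fin d → ZMod M) → ℝ) → ℂ))))
              (mulExt ((v : activitySpace Q.normParams k) : Finset (Fin d → ZMod M) → ((Fin d → ZMod M) → ℝ) → ℂ)) X ψ)
        (l * esum y * esum z * max ‖u‖ cv) := by
  obtain ⟨M₁, ρ₀, hM₁, hρ₀, hU1⟩ := exists_weakNormLE_nextK_freeHt_ball P hr0
  obtain ⟨ℓH, hℓH0, hnextH⟩ := P.exists_hamNorm_nextH_sub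
  -- the threshold: `ℓ_H T₂ r ≤ ρ₀/16`
  set T₂ : ℝ := ρ₀ / (16 * (ℓH + 1) * (P.r + 1)) with hT₂def
  have hT₂0 : 0 < T₂ := by positivity
  have hT₂ρ : ℓH * T₂ * P.r ≤ ρ₀ / 16 := by
    have h2 : ℓH * T₂ * P.r ≤ (ℓH + 1) * (ρ₀ / (16 * (ℓH + 1) * (P.r + 1))) * (P.r + 1) :=
      mul_le_mul (mul_le_mul (by linarith : ℓH ≤ ℓH + 1) le_rfl hT₂0.le (by linarith))
        (by linarith : P.r ≤ P.r + 1) P.hr0 (by positivity)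
    have h3 : (ℓH + 1) * (ρ₀ / (16 * (ℓH + 1) * (P.r + 1))) * (P.r + 1) = ρ₀ / 16 := by
      field_simp
    linarith [h2, h3.le]
  set l : ℝ := ((P.r₀ : ℝ) + 1) * 64 * M₁ * ℓH ^ 2 * P.r / ρ₀ ^ 2 with hldef
  have hl0 : 0 ≤ l := by rw [hldef]; have := P.hr0; positivity
  refine ⟨l, T₂, hl0, hT₂0, fun N M _ Q => ?_⟩
  intro q y z hq hqy hqz hqyz hy hz k hk u v cv hu hv hcv
  -- sizes and the state
  have hPA : 0 < Q.normParams.A := P.A_pos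
  have hL0r : (0 : ℝ) < P.L := by exact_mod_cast P.hLodd.pos
  have h𝔥 : 0 < fieldWt P.h (P.L : ℝ) d k := fieldWt_pos P.hh hL0r d k
  have hRk : (0 : ℝ) < (P.L : ℝ) ^ k := pow_pos hL0r k
  have hnpos : 0 < P.L ^ (d * k) := pow_pos P.hLodd.pos _
  have hnn : ∀ G : RelevantHamiltonian ℂ d, 0 ≤ hamNorm (fieldWt P.h (P.L : ℝ) d k) ((P.L : ℝ) ^ k) (P.L ^ (d * k)) G :=
    fun G => hamNorm_nonneg h𝔥.le hRk.le _ _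
  have hMt : M = Q.normParams.L ^ k * P.L ^ (N - k) := by
    show M = P.L ^ k * P.L ^ (N - k)
    rw [Q.hM, ← pow_add, Nat.add_sub_cancel' (by omega)]
  have hcv0 : 0 ≤ cv := nonneg_of_weakNormLE hPA hMt P.hLodd.pow P.hLodd.pow hv
  set mx := max ‖u‖ cv with hmxdef
  have hmx0 : 0 ≤ mx := le_max_of_le_left (norm_nonneg _)
  have hmxr : mx ≤ P.r := max_le hu hcv
  have hy0 : 0 ≤ esum y := entrySum_nonneg _
  have hz0 : 0 ≤ esum z := entrySum_nonneg _
  set H := HamSpace.toHam u with hHdef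
  set Kf := mulExt ((v : activitySpace Q.normParams k) :
    Finset (Fin d → ZMod M) → ((Fin d → ZMod M) → ℝ) → ℂ) with hKfdef
  have hnormu : hamNorm (fieldWt P.h (P.L : ℝ) d k) ((P.L : ℝ) ^ k) (P.L ^ (d * k)) H = ‖u‖ := by
    rw [hHdef, HamSpace.norm_def]
  have hH8 : hamNorm (fieldWt P.h (P.L : ℝ) d k) ((P.L : ℝ) ^ k) (P.L ^ (d * k)) H ≤ 1 / 8 := by
    rw [hnormu]; exact hu.trans (P.hr.trans (by norm_num))
  have hva : WeakNormLE Q.normParams k ((v : activitySpace Q.normParams k) :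
      Finset (Fin d → ZMod M) → ((Fin d → ZMod M) → ℝ) → ℂ) cv := hv
  set D00 := abkmStepData P.L P.R k (Q.kernels q) with hD00
  set D10 := abkmStepData P.L P.R k (Q.kernels (q + y)) with hD10
  set D01 := abkmStepData P.L P.R k (Q.kernels (q + z)) with hD01
  set D11 := abkmStepData P.L P.R k (Q.kernels (q + y + z)) with hD11
  set Ht00 := nextH D00 H Kf with hHt00
  set Ht10 := nextH D10 H Kf with hHt10
  set Ht01 := nextH D01 H Kf with hHt01
  set Ht11 := nextH D11 H Kf with hHt11
  set δy := Ht10 - Ht00 with hδydef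
  set δz := Ht01 - Ht00 with hδzdef
  set ny := hamNorm (fieldWt P.h (P.L : ℝ) d k) ((P.L : ℝ) ^ k) (P.L ^ (d * k)) δy with hnydef
  set nz := hamNorm (fieldWt P.h (P.L : ℝ) d k) ((P.L : ℝ) ^ k) (P.L ^ (d * k)) δz with hnzdef
  have hny0 : 0 ≤ ny := hnn _
  have hnz0 : 0 ≤ nz := hnn _
  -- the sizes of the sides
  have hδy : ny ≤ ℓH * esum y * mx := by
    have h := hnextH N M Q q (q + y) hq hqy k hk u v cv hv
    rw [add_sub_cancel_left] at h
    exact h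
  have hδz : nz ≤ ℓH * esum z * mx := by
    have h := hnextH N M Q q (q + z) hq hqz k hk u v cv hv
    rw [add_sub_cancel_left] at h
    exact h
  have h1110 : hamNorm (fieldWt P.h (P.L : ℝ) d k) ((P.L : ℝ) ^ k) (P.L ^ (d * k)) (Ht11 - Ht10) ≤ ℓH * esum z * mx := by
    have h := hnextH N M Q (q + y) (q + y + z) hqy hqyz k hk u v cv hv
    rw [add_sub_cancel_left] at h
    exact h
  have hymx : ℓH * esum y * mx ≤ ρ₀ / 16 :=
    le_trans (mul_le_mul (mul_le_mul_of_nonneg_left hy hℓH0) hmxr hmx0 (by positivity)) hT₂ρ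
  have hzmx : ℓH * esum z * mx ≤ ρ₀ / 16 :=
    le_trans (mul_le_mul (mul_le_mul_of_nonneg_left hz hℓH0) hmxr hmx0 (by positivity)) hT₂ρ
  have hnyρ : ny ≤ ρ₀ / 16 := hδy.trans hymx
  have hnzρ : nz ≤ ρ₀ / 16 := hδz.trans hzmx
  have hrhs0 : 0 ≤ l * esum y * esum z * mx := by positivity
  by_cases hy00 : ny = 0
  · -- `δ_y = 0`
    have hδ : δy = 0 := eq_zero_of_hamNorm_eq_zero h𝔥 hRk hnpos hy00
    have hHt : Ht10 = Ht00 := sub_eq_zero.1 hδ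
    intro X hX hXc φ
    simp only [hHt, add_sub_cancel_left, sub_sub_cancel_left, neg_add_cancel]
    rw [tayNorm_const, norm_zero]
    exact mul_nonneg (mul_nonneg hrhs0 (WeakNormLE.aFactor_pos hPA (k + 1) X).le)
      ((Q.normParams.W.weight_pos (k + 1) X φ).le)
  by_cases hz00 : nz = 0
  · -- `δ_z = 0`
    have hδ : δz = 0 := eq_zero_of_hamNorm_eq_zero h𝔥 hRk hnpos hz00
    have hHt : Ht01 = Ht00 := sub_eq_zero.1 hδ
    intro X hX hXc φ
    simp only [hHt, add_sub_cancel_right, sub_self, zero_sub, neg_add_cancel]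
    rw [tayNorm_const, norm_zero]
    exact mul_nonneg (mul_nonneg hrhs0 (WeakNormLE.aFactor_pos hPA (k + 1) X).le)
      ((Q.normParams.W.weight_pos (k + 1) X φ).le)
  -- both sides nonzero: the bidisc engine
  have hnypos : 0 < ny := lt_of_le_of_ne hny0 (Ne.symm hy00)
  have hnzpos : 0 < nz := lt_of_le_of_ne hnz0 (Ne.symm hz00)
  set W₂ : RelevantHamiltonian ℂ d := ((ny / nz : ℝ) : ℂ) • δz with hW₂
  set τ₀ : ℂ := ((nz / ny : ℝ) : ℂ) with hτ₀
  have hW₂n : hamNorm (fieldWt P.h (P.L : ℝ) d k) ((P.L : ℝ) ^ k) (P.L ^ (d * k)) W₂ = ny := by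
    rw [hW₂, hamNorm_complex_smul, Complex.norm_real, Real.norm_eq_abs, abs_of_pos (by positivity)]
    rw [← hnzdef]; field_simp
  have hτ₀n : ‖τ₀‖ = nz / ny := by
    rw [hτ₀, Complex.norm_real, Real.norm_eq_abs, abs_of_pos (by positivity)]
  have hτW : τ₀ • W₂ = δz := by
    rw [hW₂, hτ₀, smul_smul, ← Complex.ofReal_mul, show nz / ny * (ny / nz) = 1 by field_simp, Complex.ofReal_one, one_smul]
  set R : ℝ := ρ₀ / (4 * ny) with hRdef
  have hR0 : 0 < R := by positivity
  have hRny : R * ny = ρ₀ / 4 := by rw [hRdef]; field_simp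
  have hR1 : (1 : ℂ) ∈ ball (0 : ℂ) R := by
    rw [mem_ball_zero_iff, norm_one, hRdef, lt_div_iff₀ (by positivity)]
    linarith [hnyρ]
  have hRτ : τ₀ ∈ ball (0 : ℂ) R := by
    rw [mem_ball_zero_iff, hτ₀n, hRdef, div_lt_div_iff₀ hnypos (by positivity)]
    nlinarith [hnzρ, hnypos]
  -- the uniform bound on the bidisc (U1)
  have hC : ∀ σ ∈ ball (0 : ℂ) R, ∀ τ ∈ ball (0 : ℂ) R, WeakNormLE Q.normParams (k + 1)
      (fun X ψ => nextK D11.s (reblock D11.s (D11.L * D11.s)) (stepMeasure D11.𝒞) (expNegH H)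
        (expNegH (Ht00 + σ • δy + τ • W₂)) Kf X ψ) M₁ := by
    intro σ hσ τ hτ
    have hσ' : ‖σ‖ ≤ R := le_of_lt (mem_ball_zero_iff.1 hσ)
    have hτ' : ‖τ‖ ≤ R := le_of_lt (mem_ball_zero_iff.1 hτ)
    refine hU1 N M Q (q + y + z) hqyz k hk u v cv hu hv hcv (Ht00 + σ • δy + τ • W₂) ?_
    have e : Ht00 + σ • δy + τ • W₂ - nextH D11 H Kf = (Ht00 - Ht11) + σ • δy + τ • W₂ := by rw [hHt11]; abel
    rw [e]
    have h1 := hamNorm_line₂_le h𝔥.le hRk.le (P.L ^ (d * k)) (Ht00 - Ht11) δy W₂ σ τ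
    rw [hW₂n] at h1
    have h2 : hamNorm (fieldWt P.h (P.L : ℝ) d k) ((P.L : ℝ) ^ k) (P.L ^ (d * k)) (Ht00 - Ht11) ≤ ny + ℓH * esum z * mx := by
      have e2 : Ht00 - Ht11 = (-δy) + (-(Ht11 - Ht10)) := by rw [hδydef]; abel
      rw [e2]
      have h := hamNorm_add_le h𝔥.le hRk.le (P.L ^ (d * k)) (-δy) (-(Ht11 - Ht10))
      rw [hamNorm_neg, hamNorm_neg] at h
      linarith [h, h1110]
    have h3 : ‖σ‖ * ny ≤ ρ₀ / 4 := by
      calc ‖σ‖ * ny ≤ R * ny := mul_le_mul_of_nonneg_right hσ' hny0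
        _ = ρ₀ / 4 := hRny
    have h4 : ‖τ‖ * ny ≤ ρ₀ / 4 := by
      calc ‖τ‖ * ny ≤ R * ny := mul_le_mul_of_nonneg_right hτ' hny0
        _ = ρ₀ / 4 := hRny
    linarith [h1, h2, h3, h4, hnyρ, hzmx]
  have hE := weakNormLE_secondDiff_nextK_freeHt_package P Q (q := q + y + z) hqyz hk hH8 hcv0 hva
    (fun Y => activitySpace.contDiff v Y) (fun Y hY hYc => activitySpace.isGaugeLocal v hY hYc) Ht00 δy W₂ hC hR1 hRτ
  -- identify the corners
  have e11 : Ht00 + (1 : ℂ) • δy + τ₀ • W₂ = Ht10 + Ht01 - Ht00 := by rw [one_smul, hτW, hδydef, hδzdef]; abel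
  have e10 : Ht00 + (1 : ℂ) • δy + (0 : ℂ) • W₂ = Ht10 := by rw [one_smul, zero_smul, add_zero, hδydef]; abel
  have e01 : Ht00 + (0 : ℂ) • δy + τ₀ • W₂ = Ht01 := by rw [zero_smul, add_zero, hτW, hδzdef]; abel
  have e00 : Ht00 + (0 : ℂ) • δy + (0 : ℂ) • W₂ = Ht00 := by rw [zero_smul, zero_smul, add_zero, add_zero]
  rw [e11, e10, e01, e00] at hE
  refine hE.mono hPA ?_
  rw [norm_one, mul_one, hτ₀n]
  have hRinv : 4 * M₁ / R ^ 2 * (nz / ny) = 64 * M₁ * ny * nz / ρ₀ ^ 2 := by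
    rw [hRdef]; field_simp; ring
  have hprod : ny * nz ≤ (ℓH * esum y * mx) * (ℓH * esum z * P.r) :=
    mul_le_mul hδy (hδz.trans (mul_le_mul_of_nonneg_left hmxr (by positivity))) hnz0 (by positivity)
  calc ((P.r₀ : ℝ) + 1) * (4 * M₁ / R ^ 2) * (nz / ny)
      = ((P.r₀ : ℝ) + 1) * (4 * M₁ / R ^ 2 * (nz / ny)) := by ring
    _ = ((P.r₀ : ℝ) + 1) * (64 * M₁ * ny * nz / ρ₀ ^ 2) := by rw [hRinv]
    _ = ((P.r₀ : ℝ) + 1) * 64 * M₁ / ρ₀ ^ 2 * (ny * nz) := by ring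
    _ ≤ ((P.r₀ : ℝ) + 1) * 64 * M₁ / ρ₀ ^ 2 * ((ℓH * esum y * mx) * (ℓH * esum z * P.r)) :=
        mul_le_mul_of_nonneg_left hprod (by positivity)
    _ = l * esum y * esum z * mx := by rw [hldef]; ring

end Summit.HubbardSuperconductivity.HubbardSuperconductivity.Theorems.ComplexGFF

end
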